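import Summits.Ventures.LatticeQCDFlow.Scaling.HubChainStartContentCoverPair

/-!
HONEST FRAMING: exact (Metropolis-corrected) sampling algorithms for lattice gauge theory; figures
of merit are autocorrelation/cost numbers at stated couplings and volumes; no continuum-physics
claim.

# HubChainStartContentCoverShallow — THE COVER IN THE LAST CONFIGURATION: THE START CLASS IS THE SHALLOWEST (RANK `0`, ONE PARTICLE) AND THE TAG IS NEXT (RANK `1`), WHERE
# `T_n(0)` IS NOT ANTITONE IN `ρ_1` — STILL `P_Yⁿ(0,0) ≤ P_Xⁿ(0,0) + P_Xⁿ(0,1)` FOR EVERY `n`, DIRECTLY FROM THE SEPARABLE FORM (lean-2 GEN-40, ours)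

Venture-side (OURS).  Cell `lqcd-flow` (pub-lqcd), unit `pub-lqcd-lean-2-g40`, 2026-08-30.  Chapter Z, file 10.  For a start class SHALLOWER than the tag, Z2 `perStep_pow_diag_le` gives
`P_Yⁿ(i,i) ≤ P_Xⁿ(i,i)` outright — under the particle condition at the tag rank, which fails in exactly one configuration: start at rank `0` and tag at rank `1`, one particle each
(`N_0 = N_1 = 1`; the second `{0,1}` pair of MEMO-gen40 §2, `T_n(0)` vs `ρ_1`).  With the star's normalisation `cM_0 = 1 + c` the levels are `a_0 = 0`, `a_1 = c`, `β_0 = −c` (both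
profiles), `β^X_1 = −r_X`, `β^Y_1 = −r_Y` with `r = cρ_0/ρ_1`, `r_Y ≤ r_X ≤ c` (the tag is deeper in `Y`), and the rank-`1` term of `ρ_0T_n(0)` is EXACTLY `cⁿ − cH_n(−r,c)`
(`(c+r)H_n(−r,c) = cⁿ − (−r)ⁿ`).  Hence, the deeper rank terms being monotone (Z2) and `P_Xⁿ(0,1) ≥ cH_n(−r_X,c)` (Z6 `cover_T_ge_first`):

* `coverC_levels`; **`startClass_cover_shallow`**: `P_Yⁿ(0,0) − P_Xⁿ(0,0) ≤ cH_n(−r_X,c) − cH_n(−r_Y,c) ≤ P_Xⁿ(0,1)` for every `n` (at least three particles).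

With Z6, Z7 and Z2 this completes Conjecture Σ in the sorted local form for EVERY pair (start class, tag) of the star (Z9, labelled: all distinct `z, s`).  TOY (`numerics/sigma_toy.py`,
exact rationals, NOTHING CLAIMED): 0 violations in this configuration among 38 080 checks.  Literature grade (cell rule): OWN, elementary; nothing cited; no new bib keys.
-/

open Finset

namespace Summit.Ventures.LatticeQCDFlow.Scaling

section Shallow
variable {m : ℕ} {ρX ρY N RX RY M βX βY a : ℕ → ℝ} {c : ℝ} {PX PY fX fY : ℕ → ℕ → ℝ} {PnX PnY : ℕ → ℕ → ℕ → ℝ} {TX TY : ℕ → ℕ → ℝ}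

/-- **Levels of the configuration `(start, tag) = (0,1)`:** `a_0 = 0`, `a_1 = c`, `β_0 = −c`, `β_1 = −cρ_0/ρ_1`, and `cρ_0/ρ_1 ≤ c` (for one sorted profile with `N_0 = N_1 = 1`,
`cM_0 = 1 + c`). [ours] -/
theorem coverC_levels (hρ : ∀ i, 0 < ρX i) (hmono : Monotone ρX)
    (hRX : ∀ k, RX k = ∑ i ∈ range k, N i * ρX i) (hM : ∀ k, M k = ∑ i ∈ Ico k m, N i)
    (hβX : ∀ k, βX k = 1 - c * (M k + RX k / ρX k)) (ha : ∀ l, a l = 1 - c * M (l + 1))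
    (hcK : c * M 0 = 1 + c) (hN0 : N 0 = 1) (hN1 : N 1 = 1) (hm : 1 < m) (hc : 0 ≤ c) :
    a 0 = 0 ∧ a 1 = c ∧ βX 0 = -c ∧ βX 1 = -(c * ρX 0 / ρX 1) ∧ c * ρX 0 / ρX 1 ≤ c := by
  have hM0 : M 0 = N 0 + M 1 := hubClass_M_succ hM (by omega)
  have hM1 : M 1 = N 1 + M 2 := hubClass_M_succ hM hm
  have hRX1 : RX 1 = ρX 0 := by rw [hRX]; simp [hN0]
  have hRX0 : RX 0 = 0 := by rw [hRX]; simp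
  have hcM1 : c * M 1 = 1 := by
    have : c * M 0 = c * N 0 + c * M 1 := by rw [hM0]; ring
    rw [hN0] at this; linarith
  have hcM2 : c * M 2 = 1 - c := by
    have : c * M 1 = c * N 1 + c * M 2 := by rw [hM1]; ring
    rw [hN1] at this; linarith
  refine ⟨?_, ?_, ?_, ?_, ?_⟩
  · rw [ha, zero_add]; linarith
  · rw [ha, show (1:ℕ) + 1 = 2 from rfl]; linarith
  · rw [hβX, hRX0, zero_div, add_zero]; linarith
  · rw [hβX, hRX1, mul_add, ← mul_div_assoc]; linarith
  · rw [mul_div_assoc]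
    have h := hmono (zero_le_one : (0:ℕ) ≤ 1)
    have : ρX 0 / ρX 1 ≤ 1 := (div_le_one (hρ 1)).mpr h
    exact mul_le_of_le_one_right hc this

/-- **THE COVER AT THE SHALLOWEST START (`(start, tag) = (0,1)`, one particle each, `cM_0 = 1 + c`, at least three particles):** `P_Yⁿ(0,0) ≤ P_Xⁿ(0,0) + P_Xⁿ(0,1)` for every `n`. [ours] -/
theorem startClass_cover_shallow (hρX : ∀ i, 0 < ρX i) (hmonoX : Monotone ρX) (hρY : ∀ i, 0 < ρY i) (hmonoY : Monotone ρY)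
    (hagree : ∀ i, i ≠ 1 → ρX i = ρY i) (htag : ρX 1 ≤ ρY 1) (hN : ∀ i, 0 < N i)
    (hRX : ∀ k, RX k = ∑ i ∈ range k, N i * ρX i) (hRY : ∀ k, RY k = ∑ i ∈ range k, N i * ρY i) (hM : ∀ k, M k = ∑ i ∈ Ico k m, N i)
    (hPXoff : ∀ i j, i ≠ j → PX i j = c * N j * min 1 (ρX j / ρX i)) (hPXdiag : ∀ i, PX i i = 1 - ∑ j ∈ (range m).erase i, PX i j)
    (hPYoff : ∀ i j, i ≠ j → PY i j = c * N j * min 1 (ρY j / ρY i)) (hPYdiag : ∀ i, PY i i = 1 - ∑ j ∈ (range m).erase i, PY i j)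
    (hfX : ∀ k i, fX k i = if i < k then ρX k else if i = k then -(RX k / N k) else 0)
    (hfY : ∀ k i, fY k i = if i < k then ρY k else if i = k then -(RY k / N k) else 0)
    (hβX : ∀ k, βX k = 1 - c * (M k + RX k / ρX k)) (hβY : ∀ k, βY k = 1 - c * (M k + RY k / ρY k)) (ha : ∀ l, a l = 1 - c * M (l + 1))
    (hPX0 : ∀ i j, PnX 0 i j = if i = j then 1 else 0) (hPXs : ∀ n i j, PnX (n + 1) i j = ∑ l ∈ range m, PnX n i l * PX l j)
    (hPY0 : ∀ i j, PnY 0 i j = if i = j then 1 else 0) (hPYs : ∀ n i j, PnY (n + 1) i j = ∑ l ∈ range m, PnY n i l * PY l j)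
    (hTX : ∀ n j, TX n j = (1 - βX j ^ n) / RX m + ∑ k ∈ Ico (j + 1) m, (1 / RX k - 1 / RX (k + 1)) * (βX k ^ n - βX j ^ n))
    (hTY : ∀ n j, TY n j = (1 - βY j ^ n) / RY m + ∑ k ∈ Ico (j + 1) m, (1 / RY k - 1 / RY (k + 1)) * (βY k ^ n - βY j ^ n))
    (hc : 0 < c) (hcK : c * M 0 = 1 + c) (hN0 : N 0 = 1) (hN1 : N 1 = 1) (hm : 1 < m) (h3 : M 3 + 3 ≤ M 0) (n : ℕ) :
    PnY n 0 0 ≤ PnX n 0 0 + PnX n 0 1 := by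
  obtain ⟨H, hH⟩ : ∃ H : ℕ → ℝ → ℝ → ℝ, ∀ n x y, H n x y = ∑ t ∈ range n, x ^ t * y ^ (n - 1 - t) := ⟨_, fun _ _ _ => rfl⟩
  obtain ⟨G, hG⟩ : ∃ G : ℕ → ℝ → ℝ → ℝ → ℝ, ∀ n a a' b, G n a a' b = ∑ q ∈ range (n - 1), a' ^ q * H (n - 1 - q) b a := ⟨_, fun _ _ _ _ => rfl⟩
  rcases n with _ | n
  · rw [hPY0, hPX0, hPX0]; norm_num
  obtain ⟨ha0, ha1, hbX0, hu, hrX⟩ := coverC_levels hρX hmonoX hRX hM hβX ha hcK hN0 hN1 hm hc.le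
  obtain ⟨-, -, hbY0, hv, hrY⟩ := coverC_levels hρY hmonoY hRY hM hβY ha hcK hN0 hN1 hm hc.le
  have hρ0 : ρX 0 = ρY 0 := hagree 0 (by omega)
  have hH0 : ∀ x : ℝ, H (n + 1) x 0 = x ^ n := fun x => by rw [sepH_zero_right hH (by omega : 1 ≤ n + 1)]; rfl
  rw [hubClass_pow_diag hρY hmonoY hN hRY hM hPYoff hPYdiag hfY hβY hPY0 hPYs hTY (n + 1) (by omega : 0 < m),
    hubClass_pow_diag hρX hmonoX hN hRX hM hPXoff hPXdiag hfX hβX hPX0 hPXs hTX (n + 1) (by omega : 0 < m),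
    hubClass_pow_offdiag hρX hmonoX hN hRX hM hPXoff hPXdiag hfX hβX hPX0 hPXs hTX (n + 1) (by omega : 0 < m) hm zero_ne_one, max_eq_right zero_le_one,
    hN0, hN1, ← hρ0,
    hubClass_T_separable hρX hN hRX hM hβX ha hTX hH (n + 1) (by omega : 0 < m), hubClass_T_separable hρY hN hRY hM hβY ha hTY hH (n + 1) (by omega : 0 < m),
    Finset.sum_eq_sum_Ico_succ_bot hm, Finset.sum_eq_sum_Ico_succ_bot hm, hbX0, hbY0, ha0, ha1]
  simp only [hH0]
  -- the deeper rank terms: `Y ≤ X` termwise (levels at ranks ≥ 2)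
  have hal : ∀ l, 2 ≤ l → 2 * c ≤ a l := fun l hl => perStep_level hN hM ha hc.le hcK.le h3 hl
  have hapos : ∀ l, 2 ≤ l → 0 < a l := fun l hl => by linarith [hal l hl]
  have hann : ∀ l, 1 ≤ l → 0 ≤ a l := by
    intro l hl
    rcases Nat.eq_or_lt_of_le hl with h | h
    · rw [← h, ha1]; exact hc.le
    · linarith [hal l (by omega)]
  have hβYl : ∀ l, 2 ≤ l → l < m → 0 ≤ a l + 2 * βY l := fun l hl hlm => perStep_beta_level hρY hmonoY hN hRY hM hβY ha hc.le hcK.le h3 hl hlm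
  have hβle : ∀ l, 1 < l → βY l ≤ βX l := fun l hl => perStep_beta_le hρY hagree htag hN hRX hRY hβX hβY hc.le hl
  have htail : ∑ l ∈ Ico (1 + 1) m, (1 / ρY l) * (H (n + 1) (βY l) (a l) - H (n + 1) (βY l) (a (l - 1)))
      ≤ ∑ l ∈ Ico (1 + 1) m, (1 / ρX l) * (H (n + 1) (βX l) (a l) - H (n + 1) (βX l) (a (l - 1))) := by
    refine sum_le_sum fun l hl => ?_
    obtain ⟨hl1, hl2⟩ := mem_Ico.mp hl
    rw [← hagree l (by omega), ← sepG_mul hH hG (n + 1) (a l) (a (l - 1)) (βY l), ← sepG_mul hH hG (n + 1) (a l) (a (l - 1)) (βX l), sep_a_step hM ha (by omega) hl2]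
    have hGle := sepG_mono hH hG (n + 1) (a' := a (l - 1)) (hapos l (by omega)) (hann (l - 1) (by omega)) (hβYl l (by omega) hl2) (hβle l (by omega))
    exact mul_le_mul_of_nonneg_left (mul_le_mul_of_nonneg_left hGle (mul_nonneg hc.le (hN l).le)) (div_nonneg zero_le_one (hρX l).le)
  -- the tag column: `P_Xⁿ(0,1) = ρ^X_1·T^X_n(1) ≥ cH_n(−r_X,c)`
  have hfirst := cover_T_ge_first hρX hmonoX hN hRX hM hβX ha hTX hH hc.le hcK.le (n + 1) hm (by rw [ha1]; exact hc.le) h3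
  rw [ha1] at hfirst
  have hρ1 := hρX 1
  have hρ0p := hρX 0
  have hρY1 := hρY 1
  have eT : c * H (n + 1) (βX 1) c ≤ ρX 1 * TX (n + 1) 1 := by
    have h := mul_le_mul_of_nonneg_left hfirst hρ1.le
    have e : ρX 1 * (c * (1 / ρX 1) * H (n + 1) (βX 1) c) = c * H (n + 1) (βX 1) c := by field_simp
    rw [e] at h; exact h
  -- the rank-1 identities `(c + r)H_n(−r,c) = cⁿ − (−r)ⁿ` for both profiles
  have hmulX := hubChain_H_mul hH (n + 1) (βX 1) c
  have hmulY := hubChain_H_mul hH (n + 1) (βY 1) c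
  have keyX : c * H (n + 1) (βX 1) c + c * ρX 0 / ρX 1 * H (n + 1) (βX 1) c = c ^ (n + 1) - βX 1 ^ (n + 1) := by
    have h : (c + c * ρX 0 / ρX 1) * H (n + 1) (βX 1) c = c ^ (n + 1) - βX 1 ^ (n + 1) := by
      rw [hu]; rw [hu] at hmulX; linear_combination (-1 : ℝ) * hmulX
    rw [← h]; ring
  rw [← hρ0] at hv hrY
  have keyY : c * H (n + 1) (βY 1) c + c * ρX 0 / ρY 1 * H (n + 1) (βY 1) c = c ^ (n + 1) - βY 1 ^ (n + 1) := by
    have h : (c + c * ρX 0 / ρY 1) * H (n + 1) (βY 1) c = c ^ (n + 1) - βY 1 ^ (n + 1) := by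
      rw [hv]; rw [hv] at hmulY; linear_combination (-1 : ℝ) * hmulY
    rw [← h]; ring
  have hHY : 0 ≤ H (n + 1) (βY 1) c := by
    rw [hv, sepH_scale hH (n + 1) hc.ne']
    refine mul_nonneg (pow_nonneg hc.le _) (geomPartial_nonneg ?_ _)
    rw [le_div_iff₀ hc]; linarith [hrY]
  have eu : βX 1 ^ (n + 1) + c * ρX 0 / ρX 1 * βX 1 ^ n = 0 := by rw [pow_succ, hu]; ring
  have ev : βY 1 ^ (n + 1) + c * ρX 0 / ρY 1 * βY 1 ^ n = 0 := by rw [pow_succ, hv]; ring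
  -- expand both sides
  have expand : ∀ (A0 ρ1 Hb bn Sg : ℝ), 1 * ρX 0 * (c * (1 / ρX 0) * A0 + c * ((1 / ρ1) * (Hb - bn) + Sg))
      = c * A0 + c * ρX 0 / ρ1 * Hb - c * ρX 0 / ρ1 * bn + ρX 0 * c * Sg := by
    intro A0 ρ1 Hb bn Sg; field_simp; ring
  rw [← hρ0, expand, expand]
  have htail' := mul_le_mul_of_nonneg_left htail (mul_nonneg hρ0p.le hc.le)
  have hcH : 0 ≤ c * H (n + 1) (βY 1) c := mul_nonneg hc.le hHY
  simp only [one_mul]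
  linarith [keyX, keyY, eu, ev, eT, htail', hcH]

end Shallow

end Summit.Ventures.LatticeQCDFlow.Scaling
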